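import Mathlib
import Summits.ValiantsHypothesis.ValiantsHypothesis.Theorems.NewtonTauWeak.Negative.Zonogon
import Summits.ValiantsHypothesis.ValiantsHypothesis.Theorems.NewtonUnitEquationsNewtonTauWeakSeparatedRank
import Summits.ValiantsHypothesis.ValiantsHypothesis.Theorems.NewtonUnitEquationsNewtonTauWeakVdpDefs
import Summits.ValiantsHypothesis.ValiantsHypothesis.Theorems.NewtonUnitEquationsNewtonTauWeakStubVertexCharts
import Summits.ValiantsHypothesis.ValiantsHypothesis.Theorems.NewtonUnitEquationsNewtonTauWeakStubChartPairCount
import Summits.ValiantsHypothesis.ValiantsHypothesis.Theorems.NewtonUnitEquationsNewtonTauWeakStubProductVertices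
import Summits.ValiantsHypothesis.ValiantsHypothesis.Theorems.NewtonUnitEquationsNewtonTauWeakHexagonDelta
import Summits.ValiantsHypothesis.ValiantsHypothesis.Theorems.NewtonUnitEquationsNewtonTauWeakHexagonSeparated
import Summits.ValiantsHypothesis.ValiantsHypothesis.Theorems.NewtonUnitEquationsNewtonTauWeakHexagonVertexTools
import Summits.ValiantsHypothesis.ValiantsHypothesis.Theorems.NewtonUnitEquationsNewtonTauWeakHexagonCases

/-!
# `NewtonUnitEquationsNewtonTauWeakHexagonThree` — sums of three hexagon products have ≤ 5000 Newton vertices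

Rung toward `stub_binomialNewtonTauCommon` (T2 = KPTT Conj. 1 at `t = 2`; crux `NewtonTauWeak`,
stmt-ValiantsHypothesis-5904), line `binomial-normal-form`, lead c3: the GLOBAL Δ-WRONSKIAN argument for sums of
three hexagon products `X(x)·Y(y)·D(xy)` (card `Cruxes/NewtonTauWeak/Lines/binomial-normal-form-delta-global.md`).

This file: the THEOREM and its T2-instance.
* `hex_vert_sum_three_le`: for x-only `X_l`, y-only `Y_l`, diagonal `D_l ∈ ℂ[X,Y]` (supports on the rays `(1,0)`,
  `(0,1)`, `(1,1)`; ANY degrees), `vert (Σ_{l<3} X_l·Y_l·D_l) ≤ 5000` — by `hex_main_case` for a column choice with a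
  nonzero minor, else by `hex_degenerate_case`.
* `hex_binomialCommon_three_rays`: hence `stub_binomialNewtonTauCommon` holds at `K = 3`, with the ABSOLUTE bound
  `5000`, for every common exponent list inside `ℕ(1,0) ∪ ℕ(0,1) ∪ ℕ(1,1)` (the digit hexagon
  `(2^i,0), (0,2^i), (2^i,2^i)` included, which the level bound `vert_binomialSum_le_levels` does not reach):
  group the binomial factors of each product by ray. [folklore: Wronskian method of Voorhoeve–van der Poorten /
  Koiran–Portier–Tavenas with the direction-killing derivation `X∂_X - Y∂_Y`]
-/

set_option linter.dupNamespace false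

noncomputable section

namespace Summit.ValiantsHypothesis.ValiantsHypothesis.Theorems.NewtonUnitEquationsNewtonTauWeak

open scoped BigOperators
open MvPolynomial
open Literature.Computability.AlgebraicComplexity (newtonVertexCount)
open Summit.ValiantsHypothesis.ValiantsHypothesis.Theorems.NewtonTauWeakVdp
open Summit.ValiantsHypothesis.ValiantsHypothesis.Theorems.NewtonTauWeak.Negative (vert)

open HexagonThree

/-! ## The theorem -/

/-- **Sums of three hexagon products have boundedly many Newton vertices.** For univariate data in
the three directions `(1,0)`, `(0,1)`, `(1,1)` — `X_l` x-only, `Y_l` y-only, `D_l` diagonal, ANY degrees —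
the Newton polygon of `Σ_{l<3} X_l·Y_l·D_l` has at most `5000` vertices.  (Main case by the global
Δ-Wronskian count for a column whose minors do not all vanish; otherwise all pairwise Wronskians vanish
and the degenerate count applies.) [folklore] -/
theorem hex_vert_sum_three_le (X Y D : Fin 3 → MvPolynomial (Fin 2) ℂ)
    (hX : ∀ l, ∀ e ∈ (X l).support, e 1 = 0) (hY : ∀ l, ∀ e ∈ (Y l).support, e 0 = 0)
    (hD : ∀ l, ∀ e ∈ (D l).support, e 0 = e 1) :
    vert (∑ l, X l * Y l * D l) ≤ 5000 := by
  classical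
  obtain ⟨Δ, hΔ⟩ := hex_exists_delta
  have hL := hex_delta_mul Δ hΔ
  change newtonVertexCount (∑ l, X l * Y l * D l) ≤ 5000
  set g : Fin 3 → MvPolynomial (Fin 2) ℂ := fun l => X l * Y l * D l with hg
  have hsum : (∑ l, X l * Y l * D l) = g 0 + g 1 + g 2 := by
    rw [Fin.sum_univ_three]
  -- the three column choices
  by_cases h12 : ¬ (Δ (g 1) * Δ (Δ (g 2)) - Δ (g 2) * Δ (Δ (g 1)) = 0 ∧
      g 1 * Δ (Δ (g 2)) - g 2 * Δ (Δ (g 1)) = 0 ∧ g 1 * Δ (g 2) - g 2 * Δ (g 1) = 0)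
  · rw [hsum]
    exact (hex_main_case Δ hΔ hL (X 0) (Y 0) (D 0) (X 1) (Y 1) (D 1) (X 2) (Y 2) (D 2)
      (hX 0) (hY 0) (hD 0) (hX 1) (hY 1) (hD 1) (hX 2) (hY 2) (hD 2) h12).trans (by norm_num)
  by_cases h02 : ¬ (Δ (g 0) * Δ (Δ (g 2)) - Δ (g 2) * Δ (Δ (g 0)) = 0 ∧
      g 0 * Δ (Δ (g 2)) - g 2 * Δ (Δ (g 0)) = 0 ∧ g 0 * Δ (g 2) - g 2 * Δ (g 0) = 0)
  · have hsum' : (∑ l, X l * Y l * D l) = g 1 + g 0 + g 2 := by rw [hsum]; ring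
    rw [hsum']
    exact (hex_main_case Δ hΔ hL (X 1) (Y 1) (D 1) (X 0) (Y 0) (D 0) (X 2) (Y 2) (D 2)
      (hX 1) (hY 1) (hD 1) (hX 0) (hY 0) (hD 0) (hX 2) (hY 2) (hD 2) h02).trans (by norm_num)
  by_cases h01 : ¬ (Δ (g 0) * Δ (Δ (g 1)) - Δ (g 1) * Δ (Δ (g 0)) = 0 ∧
      g 0 * Δ (Δ (g 1)) - g 1 * Δ (Δ (g 0)) = 0 ∧ g 0 * Δ (g 1) - g 1 * Δ (g 0) = 0)
  · have hsum' : (∑ l, X l * Y l * D l) = g 2 + g 0 + g 1 := by rw [hsum]; ring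
    rw [hsum']
    exact (hex_main_case Δ hΔ hL (X 2) (Y 2) (D 2) (X 0) (Y 0) (D 0) (X 1) (Y 1) (D 1)
      (hX 2) (hY 2) (hD 2) (hX 0) (hY 0) (hD 0) (hX 1) (hY 1) (hD 1) h01).trans (by norm_num)
  -- all pairwise Wronskians vanish
  push Not at h12 h02 h01
  have w12 : g 1 * Δ (g 2) = g 2 * Δ (g 1) := sub_eq_zero.mp h12.2.2
  have w02 : g 0 * Δ (g 2) = g 2 * Δ (g 0) := sub_eq_zero.mp h02.2.2
  have w01 : g 0 * Δ (g 1) = g 1 * Δ (g 0) := sub_eq_zero.mp h01.2.2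
  have hW : ∀ a b, (X a * Y a * D a) * Δ (X b * Y b * D b) = (X b * Y b * D b) * Δ (X a * Y a * D a) := by
    intro a b
    change g a * Δ (g b) = g b * Δ (g a)
    fin_cases a <;> fin_cases b
    · rfl
    · exact w01
    · exact w02
    · exact w01.symm
    · rfl
    · exact w12
    · exact w02.symm
    · exact w12.symm
    · rfl
  exact (hex_degenerate_case Δ hΔ X Y D hX hY hD hW).trans (by norm_num)

namespace HexagonThree

/-- Support of a binomial factor `1 - ρ·X^d`: only `0` and `d`. [folklore] -/
theorem mem_support_binomial {ρ : ℂ} {d e : Fin 2 →₀ ℕ}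
    (he : e ∈ (1 - C ρ * monomial d (1 : ℂ) : MvPolynomial (Fin 2) ℂ).support) : e = 0 ∨ e = d := by
  classical
  rw [C_mul_monomial, mul_one] at he
  have h := support_sub (σ := Fin 2) (1 : MvPolynomial (Fin 2) ℂ) (monomial d ρ) he
  rcases Finset.mem_union.mp h with h | h
  · rw [← C_1, ← monomial_zero'] at h
    exact Or.inl (Finset.mem_singleton.mp (support_monomial_subset h))
  · exact Or.inr (Finset.mem_singleton.mp (support_monomial_subset h))

/-- A support property stable under products and true for `1` passes to finite products. [folklore] -/
theorem support_prod_induction {ι : Type*} (s : Finset ι) (f : ι → MvPolynomial (Fin 2) ℂ)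
    (P : (Fin 2 →₀ ℕ) → Prop) (hP0 : P 0)
    (hmul : ∀ p q : MvPolynomial (Fin 2) ℂ, (∀ e ∈ p.support, P e) → (∀ e ∈ q.support, P e) →
      ∀ e ∈ (p * q).support, P e)
    (hf : ∀ i ∈ s, ∀ e ∈ (f i).support, P e) : ∀ e ∈ (∏ i ∈ s, f i).support, P e := by
  classical
  refine Finset.prod_induction f (fun p : MvPolynomial (Fin 2) ℂ => ∀ e ∈ p.support, P e) hmul ?_ hf
  intro e he
  rw [← C_1, ← monomial_zero'] at he
  rw [Finset.mem_singleton.mp (support_monomial_subset he)]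
  exact hP0

end HexagonThree

/-- **T2 for `K = 3` on three rays (corollary).** KPTT's binomial statement `stub_binomialNewtonTauCommon`
holds — with an ABSOLUTE bound, uniformly in `N` and in the exponents — for `K = 3` products over any common
exponent list `d_j` contained in the three lines `ℕ·(1,0) ∪ ℕ·(0,1) ∪ ℕ·(1,1)` (e.g. the digit hexagon
`(2^i,0), (0,2^i), (2^i,2^i)`, which the level bound does not reach): group the factors of each product by
ray, `C(c_l)·Π_j(1 - ρ_{lj}X^{d_j}) = X_l·Y_l·D_l`, and apply `hex_vert_sum_three_le`. [folklore] -/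
theorem hex_binomialCommon_three_rays (N : ℕ) (c : Fin 3 → ℂ) (ρ : Fin 3 → Fin N → ℂ)
    (d : Fin N → (Fin 2 →₀ ℕ)) (hd : ∀ j, (d j) 1 = 0 ∨ (d j) 0 = 0 ∨ (d j) 0 = (d j) 1) :
    vert (∑ l, C (c l) * ∏ j, (1 - C (ρ l j) * monomial (d j) 1)) ≤ 5000 := by
  classical
  set fac : Fin 3 → Fin N → MvPolynomial (Fin 2) ℂ := fun l j => 1 - C (ρ l j) * monomial (d j) 1
    with hfac
  set px : Fin N → Prop := fun j => (d j) 1 = 0 with hpx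
  set py : Fin N → Prop := fun j => (d j) 0 = 0 with hpy
  set X : Fin 3 → MvPolynomial (Fin 2) ℂ := fun l => C (c l) * ∏ j ∈ Finset.univ.filter px, fac l j
    with hX
  set Y : Fin 3 → MvPolynomial (Fin 2) ℂ := fun l =>
    ∏ j ∈ (Finset.univ.filter fun j => ¬ px j).filter py, fac l j with hY
  set D : Fin 3 → MvPolynomial (Fin 2) ℂ := fun l =>
    ∏ j ∈ (Finset.univ.filter fun j => ¬ px j).filter (fun j => ¬ py j), fac l j with hD
  -- regrouping the products
  have hsplit : ∀ l, C (c l) * ∏ j, fac l j = X l * Y l * D l := by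
    intro l
    simp only [hX, hY, hD]
    rw [← Finset.prod_filter_mul_prod_filter_not Finset.univ px,
      ← Finset.prod_filter_mul_prod_filter_not (Finset.univ.filter fun j => ¬ px j) py]
    ring
  have hsum : (∑ l, C (c l) * ∏ j, (1 - C (ρ l j) * monomial (d j) 1)) = ∑ l, X l * Y l * D l :=
    Finset.sum_congr rfl fun l _ => hsplit l
  rw [hsum]
  -- support classes of the factors
  have hfx : ∀ l, ∀ j ∈ Finset.univ.filter px, ∀ e ∈ (fac l j).support, e 1 = 0 := by
    intro l j hj e he
    rcases HexagonThree.mem_support_binomial he with rfl | rfl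
    · rfl
    · exact (Finset.mem_filter.mp hj).2
  have hfy : ∀ l, ∀ j ∈ (Finset.univ.filter fun j => ¬ px j).filter py, ∀ e ∈ (fac l j).support,
      e 0 = 0 := by
    intro l j hj e he
    rcases HexagonThree.mem_support_binomial he with rfl | rfl
    · rfl
    · exact (Finset.mem_filter.mp hj).2
  have hfd : ∀ l, ∀ j ∈ (Finset.univ.filter fun j => ¬ px j).filter (fun j => ¬ py j),
      ∀ e ∈ (fac l j).support, e 0 = e 1 := by
    intro l j hj e he
    rcases HexagonThree.mem_support_binomial he with rfl | rfl
    · rfl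
    · obtain ⟨hj1, hj2⟩ := Finset.mem_filter.mp hj
      have hj1' := (Finset.mem_filter.mp hj1).2
      rcases hd j with h | h | h
      · exact absurd h hj1'
      · exact absurd h hj2
      · exact h
  refine hex_vert_sum_three_le X Y D (fun l => ?_) (fun l => ?_) (fun l => ?_)
  · intro e he
    obtain ⟨a, ha, b, hb, rfl⟩ := Finset.mem_add.mp (support_mul _ _ he)
    rw [← monomial_zero'] at ha
    have ha0 : a = 0 := Finset.mem_singleton.mp (support_monomial_subset ha)
    have hb1 : b 1 = 0 := HexagonThree.support_prod_induction _ _ (fun e => e 1 = 0) rfl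
      (fun p q hp hq => hex_xonly_mul p q hp hq) (hfx l) b hb
    simp [ha0, hb1]
  · exact HexagonThree.support_prod_induction _ _ (fun e => e 0 = 0) rfl
      (fun p q hp hq => hex_yonly_mul p q hp hq) (hfy l)
  · exact HexagonThree.support_prod_induction _ _ (fun e => e 0 = e 1) rfl
      (fun p q hp hq => hex_diag_mul p q hp hq) (hfd l)

end Summit.ValiantsHypothesis.ValiantsHypothesis.Theorems.NewtonUnitEquationsNewtonTauWeak

end
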